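import Summits.NavierStokesRegularity.NavierStokesRegularity.Theorems.TypeICertificateLadderRungReynoldsOneWeightedSliceIBP
import Literature.Analysis.FluidPDE.VectorCalculusProofs
import Literature.Analysis.FluidPDE.TaoEnstrophyLocalisation

/-!
# The weighted `L^{5/2}` vorticity slice inequality — crux stmt-NavierStokesRegularity-2882
(`TypeICertificateLadder.RungReynoldsOne`), line `lp-vorticity-young-budget`, stub
`stub_weightedVorticitySlice` (S1)

For a smooth divergence-free velocity `v : ℝ³ → ℝ³` with vorticity `ω = curl v`, bounded with
bounded gradient and `Dv, D²v, D³v ∈ L²`, and a field `W` whose curl satisfies the vorticity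
equation `curl W = νΔω − (v·∇)ω + (ω·∇)v` (so `W = ∂ₜu`, `v = u(t)` for a classical solution),
we prove the one-time weighted budget

`∫ (|ω|²+1)^{1/4} ⟪ω, curl W⟫ ≤ (3/(8ν)) ∫ |v|² (|ω|²+1)^{1/4} |ω|²`

(`stub_weightedVorticitySlice`), i.e. `d/dt ∫ F(ω) ≤ (15/(16ν)) ‖v‖²_∞ ∫ (|ω|²+1)^{1/4}|ω|²`
for the convex potential `F(y) = (|y|²+1)^{5/4} − 1`, `∇F(y) = (5/2)(|y|²+1)^{1/4} y`.

Proof (all three terms integrated over `ℝ³`, `wt = (|ω|²+1)^{1/4}`, `Φ(ω) = wt ω`; the three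
integrations by parts are in `…WeightedSliceIBP.lean`, the pointwise calculus in
`…WeightedSliceTools.lean`):
* transport `∫ wt ⟪ω, (v·∇)ω⟫ = (2/5) ∫ ⟪∇(F∘ω), v⟫ = 0` (`div v = 0`) — `weightedSlice_transport`;
* viscosity `∫ ⟪Δω, Φ(ω)⟫ = −∫ Σᵢ ⟪∂ᵢω, ∂ᵢ(Φ∘ω)⟫` — `weightedSlice_viscous`;
* stretching `∫ wt ⟪ω, (ω·∇)v⟫ = Σⱼ ∫ ⟪ωⱼ Φ(ω), ∂ⱼv⟫ = −∫ ⟪D(Φ∘ω)(ω), v⟫` (integration by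
  parts onto `v`, `div ω = 0`) — `weightedSlice_stretching`;
* the pointwise Young budget `WeightedSlice.pointwise_budget` absorbs the stretching density into
  the two non-negative viscous pieces `wt Σᵢ‖∂ᵢω‖²` and `(wt/(2(|ω|²+1))) Σᵢ⟪ω, ∂ᵢω⟫²` with the
  sharp factor `(1 + 1/2)/4 = 3/8` — `weightedSlice_pointwise`, `weightedSlice_budget`.

The general statement for an arbitrary smooth solenoidal `ω` is `weightedSlice_budget`; the stub
specialises it to `ω = curl v` (`div curl = 0`, `divergence_curl_eq_zero_holds`), with the `L²`
bounds of `ω, ∂ᵢω, ∂ᵢ∂ᵢω` read off from `Dv, D²v, D³v ∈ L²` through `‖curlCLM‖`. The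
hypotheses on `W` itself (smoothness, `DW ∈ L²`) are not needed: `curl W` is given pointwise by
the vorticity equation.

Sources: the `q = 5/2` case of the `L^q`-vorticity energy method (H. Beirão da Veiga, *Chinese
Ann. Math. Ser. B* 16 (1995), §2), here with a smooth weight; P. G. Lemarié-Rieusset, *The
Navier–Stokes Problem in the 21st Century* (2016), §11.6 (vorticity equation (11.60)). The
computation itself is elementary. [folklore]
-/

noncomputable section

open Set Filter Topology MeasureTheory
open scoped RealInnerProductSpace ENNReal NNReal Laplacian ContDiff
open Literature.Analysis.FluidPDE

namespace Summit.NavierStokesRegularity.NavierStokesRegularity.Theorems.RungReynoldsOne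

-- the problem directory repeats the summit name (`NavierStokesRegularity/NavierStokesRegularity`)
set_option linter.dupNamespace false

open WeightedSlice

local notation "E3" => EuclideanSpace ℝ (Fin 3)

/-- The weighted field `Φ∘w = (‖w‖²+1)^{1/4} w` of a field `w` (syntactic abbreviation). -/
local notation "Φ[" w "]" => fun y => (‖w y‖ ^ 2 + 1) ^ (1 / 4 : ℝ) • w y

/-! ### The pointwise budget and the assembly -/

/-- The pointwise Young budget `WeightedSlice.pointwise_budget` written for the composite field:
`−(ν Σᵢ ⟪∂ᵢw, ∂ᵢ(Φ∘w)⟫ + ⟪D(Φ∘w)(w), V⟫) ≤ (3/(8ν)) ‖V‖² (‖w‖²+1)^{1/4} ‖w‖²` at every point.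
[folklore] -/
theorem weightedSlice_pointwise {ν : ℝ} (hν : 0 < ν) {w : E3 → E3} (hw : Differentiable ℝ w)
    (x V : E3) :
    -(ν * ∑ i, ⟪fderiv ℝ w x (EuclideanSpace.basisFun (Fin 3) ℝ i),
          fderiv ℝ Φ[w] x (EuclideanSpace.basisFun (Fin 3) ℝ i)⟫ +
        ⟪fderiv ℝ Φ[w] x (w x), V⟫) ≤
      3 / (8 * ν) * (‖V‖ ^ 2 * ((‖w x‖ ^ 2 + 1) ^ (1 / 4 : ℝ) * ‖w x‖ ^ 2)) := by
  simp_rw [fderiv_weightedField_apply (hw x)]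
  exact pointwise_budget hν (fderiv ℝ w x) (w x) V

/-- **The weighted `L^{5/2}` budget for a solenoidal field.** Let `v ∈ C¹(ℝ³; ℝ³)` be divergence
free, `|v| ≤ M`, `‖Dv‖ ≤ B`; let `w ∈ C³(ℝ³; ℝ³)` with `div w = 0`, bounded weight
`(‖w‖²+1)^{1/4} ≤ W₀` and `w, ∂ᵢw, ∂ᵢ∂ᵢw ∈ L²`; and let `Z = νΔw − (v·∇)w + (w·∇)v`. Then
`∫ (‖w‖²+1)^{1/4} ⟪w, Z⟫ ≤ (3/(8ν)) ∫ ‖v‖² (‖w‖²+1)^{1/4} ‖w‖²`. [folklore] -/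
theorem weightedSlice_budget {ν : ℝ} (hν : 0 < ν) {v w Z : E3 → E3} (hv : ContDiff ℝ 1 v)
    (hw : ContDiff ℝ 3 w) (hdiv : VectorCalculus.IsDivFree v)
    (hdivw : ∀ x, VectorCalculus.divergence w x = 0)
    (hZ : ∀ x, Z x = ν • (Δ w) x - fderiv ℝ w x (v x) + fderiv ℝ v x (w x))
    {M B W₀ : ℝ} (hM : ∀ x, ‖v x‖ ≤ M) (hB : ∀ x, ‖fderiv ℝ v x‖ ≤ B)
    (hwt : ∀ x, (‖w x‖ ^ 2 + 1) ^ (1 / 4 : ℝ) ≤ W₀)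
    (l2w : ∫⁻ x, ‖w x‖ₑ ^ 2 < ⊤)
    (l2dw : ∀ i, ∫⁻ x, ‖fderiv ℝ w x (EuclideanSpace.basisFun (Fin 3) ℝ i)‖ₑ ^ 2 < ⊤)
    (l2ddw : ∀ i, ∫⁻ x, ‖fderiv ℝ (fun y => fderiv ℝ w y (EuclideanSpace.basisFun (Fin 3) ℝ i)) x
      (EuclideanSpace.basisFun (Fin 3) ℝ i)‖ₑ ^ 2 < ⊤) :
    ∫ x, (‖w x‖ ^ 2 + 1) ^ (1 / 4 : ℝ) * ⟪w x, Z x⟫ ≤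
      3 / (8 * ν) * ∫ x, ‖v x‖ ^ 2 * ((‖w x‖ ^ 2 + 1) ^ (1 / 4 : ℝ) * ‖w x‖ ^ 2) := by
  have hw2 : ContDiff ℝ 2 w := hw.of_le (by norm_num)
  have hdw : Differentiable ℝ w := hw2.differentiable two_ne_zero
  obtain ⟨iLap, iVisc, hVisc⟩ := weightedSlice_viscous hw hwt l2w l2dw l2ddw
  obtain ⟨iTr, hTr⟩ := weightedSlice_transport hv hw2 hdiv hM hB hwt l2w l2dw
  obtain ⟨iStr0, iStr, hStr⟩ := weightedSlice_stretching hv hw2 hdivw hM hB hwt l2w l2dw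
  -- the right-hand side is integrable
  have cv : Continuous v := hv.continuous
  have cw : Continuous w := hw.continuous
  have cwt : Continuous fun x => (‖w x‖ ^ 2 + 1) ^ (1 / 4 : ℝ) :=
    ((cw.norm.pow 2).add continuous_const).rpow_const fun x => Or.inr (by norm_num)
  have irhs : Integrable (fun x => ‖v x‖ ^ 2 * ((‖w x‖ ^ 2 + 1) ^ (1 / 4 : ℝ) * ‖w x‖ ^ 2))
      volume := by
    refine integrable_of_norm_le_const_mul_mul (M ^ 2 * W₀)
      ((cv.norm.pow 2).mul (cwt.mul (cw.norm.pow 2))) cw cw l2w l2w fun x => ?_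
    have hM0 : 0 ≤ M := (norm_nonneg _).trans (hM x)
    have hwt0 : 0 ≤ (‖w x‖ ^ 2 + 1) ^ (1 / 4 : ℝ) := Real.rpow_nonneg (by positivity) _
    rw [Real.norm_of_nonneg (by positivity)]
    have h1 : ‖v x‖ ^ 2 ≤ M ^ 2 := pow_le_pow_left₀ (norm_nonneg _) (hM x) 2
    calc ‖v x‖ ^ 2 * ((‖w x‖ ^ 2 + 1) ^ (1 / 4 : ℝ) * ‖w x‖ ^ 2)
        ≤ M ^ 2 * (W₀ * ‖w x‖ ^ 2) := by
          refine mul_le_mul h1 ?_ (by positivity) (by positivity)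
          exact mul_le_mul_of_nonneg_right (hwt x) (by positivity)
      _ = M ^ 2 * W₀ * ‖w x‖ * ‖w x‖ := by ring
  -- pointwise decomposition of the integrand
  have hfun : (fun x => (‖w x‖ ^ 2 + 1) ^ (1 / 4 : ℝ) * ⟪w x, Z x⟫) = fun x =>
      ν * ⟪(Δ w) x, (‖w x‖ ^ 2 + 1) ^ (1 / 4 : ℝ) • w x⟫ -
        (‖w x‖ ^ 2 + 1) ^ (1 / 4 : ℝ) * ⟪w x, fderiv ℝ w x (v x)⟫ +
        (‖w x‖ ^ 2 + 1) ^ (1 / 4 : ℝ) * ⟪w x, fderiv ℝ v x (w x)⟫ := by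
    funext x
    have hc : ⟪(Δ w) x, (‖w x‖ ^ 2 + 1) ^ (1 / 4 : ℝ) • w x⟫ =
        (‖w x‖ ^ 2 + 1) ^ (1 / 4 : ℝ) * ⟪w x, (Δ w) x⟫ := by
      rw [real_inner_smul_right, real_inner_comm]
    rw [hc, hZ x]
    simp only [inner_add_right, inner_sub_right, real_inner_smul_right]
    ring
  have iAB : Integrable (fun x => ν * ⟪(Δ w) x, (‖w x‖ ^ 2 + 1) ^ (1 / 4 : ℝ) • w x⟫ -
      (‖w x‖ ^ 2 + 1) ^ (1 / 4 : ℝ) * ⟪w x, fderiv ℝ w x (v x)⟫) volume :=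
    (iLap.const_mul ν).sub iTr
  rw [hfun, integral_add iAB iStr0, integral_sub (iLap.const_mul ν) iTr,
    integral_const_mul, hVisc, hTr, hStr, sub_zero]
  have hcomb : ν * -(∫ x, ∑ i, ⟪fderiv ℝ w x (EuclideanSpace.basisFun (Fin 3) ℝ i),
        fderiv ℝ Φ[w] x (EuclideanSpace.basisFun (Fin 3) ℝ i)⟫) +
      -(∫ x, ⟪fderiv ℝ Φ[w] x (w x), v x⟫) =
      ∫ x, -(ν * ∑ i, ⟪fderiv ℝ w x (EuclideanSpace.basisFun (Fin 3) ℝ i),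
        fderiv ℝ Φ[w] x (EuclideanSpace.basisFun (Fin 3) ℝ i)⟫ +
          ⟪fderiv ℝ Φ[w] x (w x), v x⟫) := by
    rw [integral_neg, integral_add (iVisc.const_mul ν) iStr, integral_const_mul]
    ring
  rw [hcomb, ← integral_const_mul]
  exact integral_mono ((iVisc.const_mul ν).add iStr).neg (irhs.const_mul _) fun x =>
    weightedSlice_pointwise hν hdw x (v x)

/-! ### The stub: `ω = curl v` -/

/-- **S1 — the weighted `L^{5/2}` vorticity slice inequality.** For smooth divergence-free `v`
with `ω = curl v`, bounded with bounded gradient and `D v, D²v, D³v ∈ L²`, and smooth `W` with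
`DW ∈ L²` satisfying the vorticity equation `curl W = νΔω − (v·∇)ω + (ω·∇)v` (`W = ∂ₜu` for a
classical solution, tree `IsClassicalNSSolutionOn.curl_timeDerivWithin_eq`):
`∫ (|ω|²+1)^{1/4}⟪ω, curl W⟫ ≤ (3/(8ν)) ∫ |v|² (|ω|²+1)^{1/4}|ω|²`.
Proof: `weightedSlice_budget` for `w = curl v` (`div curl v = 0`, `divergence_curl_eq_zero_holds`);
the `L²` bounds of `ω, ∂ᵢω, ∂ᵢ∂ᵢω` follow from `Dv, D²v, D³v ∈ L²` via `‖curlCLM‖`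
(`norm_curl_le`, `norm_fderiv_curl_le`, `ContinuousLinearMap.iteratedFDeriv_comp_left`).
[folklore] -/
theorem stub_weightedVorticitySlice :
    ∀ ⦃ν : ℝ⦄, 0 < ν →
    ∀ ⦃v W : EuclideanSpace ℝ (Fin 3) → EuclideanSpace ℝ (Fin 3)⦄,
      ContDiff ℝ ∞ v → ContDiff ℝ ∞ W → VectorCalculus.IsDivFree v →
      (∀ x, curl W x = ν • (Δ (curl v)) x - convect v (curl v) x + convect (curl v) v x) →
    ∀ ⦃M B : ℝ⦄, (∀ x, ‖v x‖ ≤ M) → (∀ x, ‖fderiv ℝ v x‖ ≤ B) →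
      (∫⁻ x, ‖iteratedFDeriv ℝ 1 v x‖ₑ ^ 2 < ⊤) → (∫⁻ x, ‖iteratedFDeriv ℝ 2 v x‖ₑ ^ 2 < ⊤) →
      (∫⁻ x, ‖iteratedFDeriv ℝ 3 v x‖ₑ ^ 2 < ⊤) → (∫⁻ x, ‖iteratedFDeriv ℝ 1 W x‖ₑ ^ 2 < ⊤) →
      ∫ x, (‖curl v x‖ ^ 2 + 1) ^ (1 / 4 : ℝ) * ⟪curl v x, curl W x⟫ ≤
        3 / (8 * ν) * ∫ x, ‖v x‖ ^ 2 * ((‖curl v x‖ ^ 2 + 1) ^ (1 / 4 : ℝ) * ‖curl v x‖ ^ 2) := by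
  intro ν hν v W hv _ hdiv hcurl M B hM hB h1 h2 h3 _
  set e := EuclideanSpace.basisFun (Fin 3) ℝ with he
  have he1 : ∀ i, ‖e i‖ = 1 := fun i => by simp [he]
  -- smoothness of the vorticity
  have hDv : ContDiff ℝ ∞ (fderiv ℝ v) := (contDiff_infty_iff_fderiv.1 hv).2
  have hω : ContDiff ℝ ∞ (curl v) := by
    rw [curl_eq_curlCLM_comp]
    exact curlCLM.contDiff.comp hDv
  have hω3 : ContDiff ℝ 3 (curl v) := hω.of_le (by norm_cast)
  have hω2 : ContDiff ℝ 2 (curl v) := hω.of_le (by norm_cast)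
  have hv1 : ContDiff ℝ 1 v := hv.of_le (by norm_cast)
  have hv2 : ContDiff ℝ 2 v := hv.of_le (by norm_cast)
  -- `div curl v = 0` and the vorticity equation
  have hdivω : ∀ x, VectorCalculus.divergence (curl v) x = 0 := fun x =>
    divergence_curl_eq_zero_holds v hv2 x
  have hZ : ∀ x, curl W x =
      ν • (Δ (curl v)) x - fderiv ℝ (curl v) x (v x) + fderiv ℝ v x (curl v x) := hcurl
  -- the weight is bounded
  have nω : ∀ x, ‖curl v x‖ ≤ ‖curlCLM‖ * B := fun x =>
    (norm_curl_le v x).trans (mul_le_mul_of_nonneg_left (hB x) (norm_nonneg curlCLM))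
  have hwt : ∀ x, (‖curl v x‖ ^ 2 + 1) ^ (1 / 4 : ℝ) ≤ (‖curlCLM‖ * B) ^ 2 + 1 := fun x =>
    (weight_le (curl v x)).trans (by
      have := pow_le_pow_left₀ (norm_nonneg _) (nω x) 2
      linarith)
  -- `ω, ∂ᵢω, ∂ᵢ∂ᵢω ∈ L²`
  have l2ω : ∫⁻ x, ‖curl v x‖ₑ ^ 2 < ⊤ := by
    refine lintegral_enorm_sq_lt_top_of_norm_le_const_mul ‖curlCLM‖ (fun x => ?_) h1
    rw [← norm_iteratedFDeriv_fderiv, norm_iteratedFDeriv_zero]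
    exact norm_curl_le v x
  have l2dω : ∀ i, ∫⁻ x, ‖fderiv ℝ (curl v) x (e i)‖ₑ ^ 2 < ⊤ := fun i => by
    refine lintegral_enorm_sq_lt_top_of_norm_le_const_mul ‖curlCLM‖ (fun x => ?_) h2
    calc ‖fderiv ℝ (curl v) x (e i)‖ ≤ ‖fderiv ℝ (curl v) x‖ := by
          simpa [he1] using (fderiv ℝ (curl v) x).le_opNorm (e i)
      _ ≤ ‖curlCLM‖ * ‖iteratedFDeriv ℝ 2 v x‖ := norm_fderiv_curl_le hv2 x
  have l2ddω : ∀ i, ∫⁻ x, ‖fderiv ℝ (fun y => fderiv ℝ (curl v) y (e i)) x (e i)‖ₑ ^ 2 < ⊤ :=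
      fun i => by
    refine lintegral_enorm_sq_lt_top_of_norm_le_const_mul ‖curlCLM‖ (fun x => ?_) h3
    calc ‖fderiv ℝ (fun y => fderiv ℝ (curl v) y (e i)) x (e i)‖
        ≤ ‖iteratedFDeriv ℝ 2 (curl v) x‖ := norm_fderiv_fderiv_apply_basisFun_le hω2 x i
      _ ≤ ‖curlCLM‖ * ‖iteratedFDeriv ℝ 3 v x‖ := by
          rw [curl_eq_curlCLM_comp, curlCLM.iteratedFDeriv_comp_left (hDv.contDiffAt (x := x))
            (i := 2) (by norm_cast), ← norm_iteratedFDeriv_fderiv]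
          exact ContinuousLinearMap.norm_compContinuousMultilinearMap_le _ _
  exact weightedSlice_budget hν hv1 hω3 hdiv hdivω hZ hM hB hwt l2ω l2dω l2ddω

end Summit.NavierStokesRegularity.NavierStokesRegularity.Theorems.RungReynoldsOne

end
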